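import Mathlib
import HarnessLib

/-!
# Euler's trace formula `Tr(αʲ / P'(α)) = [j = m - 1]` and the totally isotropic half of the scaled trace form
# `⟨1 / P'(α)⟩` (companion of `CorCM/CMWeilSplitArithmeticCore`)

Cell `pub-hodgecm2` (COR-CM), binder seat b25 (gen 52), count-neutral own lane CM-WEIL-SPLIT; KERNEL ONLY (theorems;
no definition, no named fact, no `sorry`; `HC_CM` does not occur).

For a finite separable extension `L/F` with a power basis `1, α, …, α^{m-1}` (`P` the minimal polynomial of `α`):

* `trace_gen_pow_div_aeval_derivative` — **Euler**: `Tr_{L/F}(αʲ / P'(α)) = 1` if `j = m - 1` and `= 0` if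
  `j < m - 1` (read off Mathlib's `Module.Basis.traceDual_powerBasis_eq`: the trace-dual of the power basis is
  `(P/(X-α))ᵢ / P'(α)`, whose top coefficient is `1 / P'(α)`);
* `trace_mul_div_aeval_derivative_eq_zero` — hence the scaled trace form `B(x, y) = Tr_{L/F}(x y / P'(α))` kills
  `αᵃ αᵇ` for `a + b ≤ m - 2`, and
* `trace_sum_mul_sum_div_eq_zero` — `B` VANISHES identically on `W = span_F(1, α, …, α^{k-1})` whenever `2k ≤ m`: for
  `m = 2k` the non-degenerate form `⟨1/P'(α)⟩` has a totally isotropic subspace of half dimension, i.e. is HYPERBOLIC —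
  the split conclusion of CM-WEIL-SPLIT Theorem A seen directly (`CMWeilSplitArithmeticCore` reaches it through the
  discriminant `N(P'(α)) · d_K = □` and Landherr; `1/P'(α)` and `P'(α)` have the same signs and the same norm class).

## References
* [FrohlichTaylor1990] A. Fröhlich, M. J. Taylor, *Algebraic Number Theory*, III §1 (Euler's formula: the dual basis of a
  power basis under the trace form).
* [vanGeemen1994HodgeAV] B. van Geemen, LNM 1594 (1994), 5.4 / (5.4.1) (hyperbolic = a totally isotropic half).
-/

noncomputable section

open Polynomial Module Finset

namespace Summit.HodgeConjecture.CorCM.CMWeilSplit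

variable {F L : Type*} [Field F] [Field L] [Algebra F L] [FiniteDimensional F L] [Algebra.IsSeparable F L]

/-- **Euler's formula.**  For a power basis `1, α, …, α^{m-1}` of a finite separable extension `L/F` with minimal
polynomial `P` of `α`: `Tr_{L/F}(αʲ / P'(α)) = 1` if `j = m - 1`, and `= 0` for `j < m - 1`. [folklore] -/
theorem trace_gen_pow_div_aeval_derivative (pb : PowerBasis F L) (j : Fin pb.dim) :
    Algebra.trace F L (pb.gen ^ (j : ℕ) / aeval pb.gen (derivative (minpoly F pb.gen))) =
      if (j : ℕ) + 1 = pb.dim then 1 else 0 := by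
  classical
  have hdim : 0 < pb.dim := pb.dim_pos
  let i : Fin pb.dim := ⟨pb.dim - 1, by omega⟩
  have h := (Module.Basis.traceDual_eq_iff (b := pb.basis) (v := pb.basis.traceDual)).1 rfl i j
  have hcoeff : (minpolyDiv F pb.gen).coeff (i : ℕ) = 1 := by
    have hnat : (minpolyDiv F pb.gen).natDegree = (i : ℕ) := by
      rw [natDegree_minpolyDiv, PowerBasis.natDegree_minpoly]
    rw [← hnat]
    exact (minpolyDiv_monic pb.isIntegral_gen).coeff_natDegree
  have hij : (j = i) ↔ ((j : ℕ) + 1 = pb.dim) := by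
    rw [Fin.ext_iff]
    change (j : ℕ) = pb.dim - 1 ↔ _
    omega
  simp only [Module.Basis.traceDual_powerBasis_eq, Algebra.traceForm_apply, PowerBasis.coe_basis, hcoeff,
    one_div_mul_eq_div, hij] at h
  exact h

/-- **Isotropy of low powers.**  With `pb`, `α = pb.gen`, `P` as above: `Tr_{L/F}(αᵃ αᵇ / P'(α)) = 0` whenever
`a + b + 2 ≤ m = [L : F]`. [folklore] -/
theorem trace_mul_div_aeval_derivative_eq_zero (pb : PowerBasis F L) {a b : ℕ} (hab : a + b + 2 ≤ pb.dim) :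
    Algebra.trace F L (pb.gen ^ a * pb.gen ^ b / aeval pb.gen (derivative (minpoly F pb.gen))) = 0 := by
  have h := trace_gen_pow_div_aeval_derivative pb ⟨a + b, by omega⟩
  rw [if_neg (by simp only; omega)] at h
  rwa [← pow_add]

/-- **The totally isotropic half.**  For coefficient vectors `x, y : Fin k → F` with `2k ≤ m`:
`Tr_{L/F}((Σ xₐ αᵃ)(Σ y_b αᵇ) / P'(α)) = 0` — the scaled trace form `⟨1/P'(α)⟩` vanishes identically on
`span_F(1, α, …, α^{k-1})`, a totally isotropic subspace of half dimension when `m = 2k` (van Geemen 5.4: hyperbolic).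
[folklore] -/
theorem trace_sum_mul_sum_div_eq_zero (pb : PowerBasis F L) {k : ℕ} (hk : 2 * k ≤ pb.dim) (x y : Fin k → F) :
    Algebra.trace F L ((∑ a, x a • pb.gen ^ (a : ℕ)) * (∑ b, y b • pb.gen ^ (b : ℕ)) /
      aeval pb.gen (derivative (minpoly F pb.gen))) = 0 := by
  rw [Finset.sum_mul, Finset.sum_div, map_sum]
  refine Finset.sum_eq_zero fun a _ => ?_
  rw [Finset.mul_sum, Finset.sum_div, map_sum]
  refine Finset.sum_eq_zero fun b _ => ?_
  have ha := a.2
  have hb := b.2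
  rw [smul_mul_smul_comm, smul_div_assoc, map_smul, trace_mul_div_aeval_derivative_eq_zero pb (by omega),
    smul_zero]

end Summit.HodgeConjecture.CorCM.CMWeilSplit

end
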